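import Mathlib.GroupTheory.Commutator.Basic
import Mathlib.GroupTheory.Index
import Mathlib.Data.ZMod.Basic
import Literature.RepresentationTheory.HeisenbergGroup.HeisenbergGroup
import Literature.RepresentationTheory.FiniteGroups.ExtraspecialCharacterDegrees
import HarnessLib

/-!
# The two axis subgroups `X × 0 × 0`, `0 × Y × 0` of a polarised Heisenberg group generate it;
in the extra-special groups `p^{1+2n}` this REFUTES Murthy 2026, Lemma 2.18 as printed

Topic `Literature/GroupTheory/SpecificGroups`; the group is the tree's polarised Heisenberg group
`Heisenberg (polar β)` (`Literature/RepresentationTheory/HeisenbergGroup/HeisenbergGroup.lean`, §5: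
`(x, y, t)(x', y', t') = (x + x', y + y', t + t' + β x y')`), whose dot-product instance
`(𝔽_pⁿ × 𝔽_pⁿ) × 𝔽_p` is the tree's model of the extra-special group of order `p^{2n+1}`
(`Literature/RepresentationTheory/FiniteGroups/ExtraspecialCharacterDegrees.lean`:
`Extraspecial.natCard_heisenbergDot`, `…natCard_center_heisenbergDot`, `…commutator_heisenbergDot` — order
`p^{2n+1}`, centre of order `p`, `G' = Z(G)`, i.e. Dornhoff's definition of extra-special, §31).

S. R. Murthy, *On the triple product property for subgroups of finite nilpotent groups of class 2*,
arXiv:2602.15796 (2026), p. 11, verbatim: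

> **Lemma 2.18.** Let `G` be an extraspecial group, which is necessarily of order `p^{1+2n}` for some
> `n ≥ 1`. If `S` and `T` are two subgroups of `G` of order `pⁿ` then `S` and `T` do not generate `G`,
> that is, `⟨S, T⟩ < G`.

This is false for every prime `p` and every `n ≥ 1`: in the extra-special group
`H = (𝔽_pⁿ × 𝔽_pⁿ) × 𝔽_p` above, the "axis" subgroups `S = {(x, 0, 0)}` and `T = {(0, y, 0)}` have
order `pⁿ` each and generate `H` — `(x, y, t) = (x,0,0)(0,y,0)(0,0,t − x·y)` and every central
`(0, 0, c)` is the commutator `[(c e₁, 0, 0), (0, e₁, 0)]` of an element of `S` with an element of `T`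
(`n = 1`, `p = 2`: `D₈ = ⟨s, rs⟩` generated by two reflections).  The note uses Lemma 2.18 in the last
step of the printed proof of its Thm. 4.1 (p. 16: "which implies that `⟨S, T⟩ = G`. But this is
directly contradicted by Lemma 2.18"), in the case "`G` is extraspecial of order `p^{1+2m}` for some
`m ≥ 2`"; the present file says nothing about the truth of Thm. 4.1 / Cor. 4.2 themselves
(`ρ₀(G) ≤ p`), only that their printed proof invokes a false lemma.

## What is here (all proved; two definitions, 0 named facts)

* `axisFst β`, `axisSnd β : Subgroup (Heisenberg (polar β))` — the subgroups `X × 0 × 0` and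
  `0 × Y × 0` (ranges of the homomorphisms `x ↦ (x, 0, 0)`, `y ↦ (0, y, 0)`; Weil 1964 n° 4), with
  `mem_axisFst_iff` / `mem_axisSnd_iff` (membership = "the other coordinate and `t` vanish"),
  `natCard_axisFst = Nat.card X`, `natCard_axisSnd = Nat.card Y`;
* `axisFst_sup_axisSnd_eq_top` — if every scalar is a value `β x y` then `axisFst β ⊔ axisSnd β = ⊤`;
* `Extraspecial.axis_heisenbergDot` — for the dot product on `𝔽_pⁿ`, `n ≥ 1`: both axis subgroups
  have order `pⁿ` and generate the group of order `p^{2n+1}` with `G' = Z(G)` of order `p`;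
* `Murthy2026_lemma218_false` — hence the printed Lemma 2.18 (quantified over all finite groups with
  `|G| = p^{2n+1}`, `|Z(G)| = p`, `G' = Z(G)`, `p` prime, `n ≥ 1`) is false.

## References
* S. R. Murthy, arXiv:2602.15796 (2026), Lemma 2.18 (p. 11) and proof of Thm. 4.1 (p. 16). [Murthy2026]
* A. Weil, Acta Math. 111 (1964), n° 4, p. 149 (the subgroups `G × 0`, `0 × G*` of `A(G)`). [Weil1964]
* L. Dornhoff, *Group Representation Theory, Part A* (1971), §31 (extra-special `p`-groups). [Dornhoff1971]
-/

open scoped commutatorElement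

namespace Literature.RepresentationTheory.HeisenbergGroup

section Axis

variable {R : Type*} [CommRing R] {X : Type*} {Y : Type*} [AddCommGroup X] [Module R X]
  [AddCommGroup Y] [Module R Y] (β : X →ₗ[R] Y →ₗ[R] R)

/-- The homomorphism `x ↦ (x, 0, 0)` from the additive group `X` into the polarised Heisenberg group
(a homomorphism because `β x 0 = 0`: `ofVec_inl_mul`). [cite: Weil1964, n° 4, p. 149] -/
def axisFstHom : Multiplicative X →* Heisenberg (polar β) where
  toFun x := Heisenberg.ofVec (polar β) (Multiplicative.toAdd x, 0)
  map_one' := by simp [Heisenberg.ofVec, Heisenberg.one_def]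
  map_mul' x x' := by rw [toAdd_mul, ofVec_inl_mul]

/-- The homomorphism `y ↦ (0, y, 0)` from the additive group `Y` into the polarised Heisenberg group
(`ofVec_inr_mul`). [cite: Weil1964, n° 4, p. 149] -/
def axisSndHom : Multiplicative Y →* Heisenberg (polar β) where
  toFun y := Heisenberg.ofVec (polar β) (0, Multiplicative.toAdd y)
  map_one' := by simp [Heisenberg.ofVec, Heisenberg.one_def]
  map_mul' y y' := by rw [toAdd_mul, ofVec_inr_mul]

/-- `axisFstHom β x = (x, 0, 0)`. [cite: Weil1964, n° 4, p. 149] -/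
@[simp] theorem axisFstHom_apply (x : Multiplicative X) :
    axisFstHom β x = Heisenberg.ofVec (polar β) (Multiplicative.toAdd x, 0) := rfl

/-- `axisSndHom β y = (0, y, 0)`. [cite: Weil1964, n° 4, p. 149] -/
@[simp] theorem axisSndHom_apply (y : Multiplicative Y) :
    axisSndHom β y = Heisenberg.ofVec (polar β) (0, Multiplicative.toAdd y) := rfl

/-- `x ↦ (x, 0, 0)` is injective. [cite: Weil1964, n° 4, p. 149] -/
theorem axisFstHom_injective : Function.Injective (axisFstHom β) := by
  intro x x' h
  have := congrArg (fun a : Heisenberg (polar β) => a.v.1) h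
  simpa using this

/-- `y ↦ (0, y, 0)` is injective. [cite: Weil1964, n° 4, p. 149] -/
theorem axisSndHom_injective : Function.Injective (axisSndHom β) := by
  intro y y' h
  have := congrArg (fun a : Heisenberg (polar β) => a.v.2) h
  simpa using this

/-- **The first axis subgroup** `X × 0 × 0 = {(x, 0, 0)}` of the polarised Heisenberg group
(abelian, isomorphic to `X`). [cite: Weil1964, n° 4, p. 149] -/
def axisFst : Subgroup (Heisenberg (polar β)) := (axisFstHom β).range

/-- **The second axis subgroup** `0 × Y × 0 = {(0, y, 0)}`. [cite: Weil1964, n° 4, p. 149] -/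
def axisSnd : Subgroup (Heisenberg (polar β)) := (axisSndHom β).range

/-- `(x, y, t) ∈ X × 0 × 0 ↔ y = 0 ∧ t = 0`. [cite: Weil1964, n° 4, p. 149] -/
theorem mem_axisFst_iff (a : Heisenberg (polar β)) : a ∈ axisFst β ↔ a.v.2 = 0 ∧ a.t = 0 := by
  constructor
  · rintro ⟨x, rfl⟩
    simp
  · rintro ⟨h2, ht⟩
    refine ⟨Multiplicative.ofAdd a.v.1, Heisenberg.ext ?_ ht.symm⟩
    · simp only [axisFstHom_apply, toAdd_ofAdd, Heisenberg.ofVec_v]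
      exact Prod.ext rfl h2.symm

/-- `(x, y, t) ∈ 0 × Y × 0 ↔ x = 0 ∧ t = 0`. [cite: Weil1964, n° 4, p. 149] -/
theorem mem_axisSnd_iff (a : Heisenberg (polar β)) : a ∈ axisSnd β ↔ a.v.1 = 0 ∧ a.t = 0 := by
  constructor
  · rintro ⟨y, rfl⟩
    simp
  · rintro ⟨h1, ht⟩
    refine ⟨Multiplicative.ofAdd a.v.2, Heisenberg.ext ?_ ht.symm⟩
    · simp only [axisSndHom_apply, toAdd_ofAdd, Heisenberg.ofVec_v]
      exact Prod.ext h1.symm rfl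

/-- `|X × 0 × 0| = |X|`. [cite: Weil1964, n° 4, p. 149] -/
theorem natCard_axisFst : Nat.card (axisFst β) = Nat.card X :=
  (Nat.card_congr (MonoidHom.ofInjective (axisFstHom_injective β)).toEquiv).symm.trans
    (Nat.card_congr Multiplicative.toAdd)

/-- `|0 × Y × 0| = |Y|`. [cite: Weil1964, n° 4, p. 149] -/
theorem natCard_axisSnd : Nat.card (axisSnd β) = Nat.card Y :=
  (Nat.card_congr (MonoidHom.ofInjective (axisSndHom_injective β)).toEquiv).symm.trans
    (Nat.card_congr Multiplicative.toAdd)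

/-- `(x, 0, 0) ∈ X × 0 × 0`. [cite: Weil1964, n° 4, p. 149] -/
theorem ofVec_inl_mem_axisFst (x : X) : Heisenberg.ofVec (polar β) (x, 0) ∈ axisFst β :=
  ⟨Multiplicative.ofAdd x, rfl⟩

/-- `(0, y, 0) ∈ 0 × Y × 0`. [cite: Weil1964, n° 4, p. 149] -/
theorem ofVec_inr_mem_axisSnd (y : Y) : Heisenberg.ofVec (polar β) (0, y) ∈ axisSnd β :=
  ⟨Multiplicative.ofAdd y, rfl⟩

/-- The factorisation `(x, y, t) = (x, 0, 0) · (0, y, 0) · (0, 0, t − β x y)`.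
[cite: Weil1964, n° 4, p. 149] -/
theorem eq_inl_mul_inr_mul_ofCenter (a : Heisenberg (polar β)) :
    a = Heisenberg.ofVec (polar β) (a.v.1, 0) * Heisenberg.ofVec (polar β) (0, a.v.2) *
      Heisenberg.ofCenter (polar β) (Multiplicative.ofAdd (a.t - β a.v.1 a.v.2)) := by
  apply Heisenberg.ext
  · simp only [Heisenberg.mul_v, Heisenberg.ofVec_v, Heisenberg.ofCenter_v, Prod.mk_add_mk, add_zero,
      zero_add, Prod.mk.eta]
  · simp only [Heisenberg.mul_t, Heisenberg.mul_v, Heisenberg.ofVec_t, Heisenberg.ofVec_v,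
      Heisenberg.ofCenter_t, Heisenberg.ofCenter_v, polar_apply, Prod.mk_add_mk, add_zero, zero_add,
      map_zero, toAdd_ofAdd]
    ring

/-- **The two axis subgroups generate the Heisenberg group** as soon as every scalar is a value of
the pairing (e.g. `β` = a dot product on `Rⁿ`, `n ≥ 1`): every central `(0, 0, c)` is a commutator
`[(x, 0, 0), (0, y, 0)]` with `β x y = c` (`commutator_inl_inr`), and
`(x, y, t) = (x,0,0)(0,y,0)(0,0,t − β x y)`. [cite: Weil1964, n° 4, p. 149]
[cite: Murthy2026, Lemma 2.18 (refuted by this for the extra-special instances)] -/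
theorem axisFst_sup_axisSnd_eq_top (hβ : ∀ c : R, ∃ x y, β x y = c) :
    axisFst β ⊔ axisSnd β = ⊤ := by
  rw [eq_top_iff]
  intro a _
  have hcen : ∀ c : R,
      Heisenberg.ofCenter (polar β) (Multiplicative.ofAdd c) ∈ axisFst β ⊔ axisSnd β := by
    intro c
    obtain ⟨x, y, hxy⟩ := hβ c
    rw [← hxy, ← commutator_inl_inr, commutatorElement_def]
    have hx : Heisenberg.ofVec (polar β) (x, 0) ∈ axisFst β ⊔ axisSnd β :=
      Subgroup.mem_sup_left (ofVec_inl_mem_axisFst β x)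
    have hy : Heisenberg.ofVec (polar β) (0, y) ∈ axisFst β ⊔ axisSnd β :=
      Subgroup.mem_sup_right (ofVec_inr_mem_axisSnd β y)
    exact mul_mem (mul_mem (mul_mem hx hy) (inv_mem hx)) (inv_mem hy)
  rw [eq_inl_mul_inr_mul_ofCenter β a]
  exact mul_mem (mul_mem (Subgroup.mem_sup_left (ofVec_inl_mem_axisFst β _))
    (Subgroup.mem_sup_right (ofVec_inr_mem_axisSnd β _))) (hcen _)

end Axis

end Literature.RepresentationTheory.HeisenbergGroup

/-! ## The extra-special instances `(𝔽_pⁿ × 𝔽_pⁿ) × 𝔽_p` -/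

namespace Literature.RepresentationTheory.FiniteGroups

open Literature.RepresentationTheory.HeisenbergGroup

namespace Extraspecial

/-- **In the extra-special group `H = (𝔽_pⁿ × 𝔽_pⁿ) × 𝔽_p` of order `p^{2n+1}` (`n ≥ 1`; `G' = Z(G)`
of order `p`) the two axis subgroups have order `pⁿ` and generate `H`.**
[cite: Murthy2026, Lemma 2.18 (refuted by this)] [cite: Dornhoff1971, §31 Definition] -/
theorem axis_heisenbergDot (p n : ℕ) (hn : 0 < n) :
    Nat.card (Heisenberg (polar (dotProductBilin (ZMod p) (ZMod p) (m := Fin n) (A := ZMod p)))) =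
        p ^ (2 * n + 1) ∧
      commutator (Heisenberg (polar (dotProductBilin (ZMod p) (ZMod p) (m := Fin n) (A := ZMod p)))) =
        Subgroup.center _ ∧
      Nat.card (Subgroup.center
        (Heisenberg (polar (dotProductBilin (ZMod p) (ZMod p) (m := Fin n) (A := ZMod p))))) = p ∧
      Nat.card (axisFst (dotProductBilin (ZMod p) (ZMod p) (m := Fin n) (A := ZMod p))) = p ^ n ∧
      Nat.card (axisSnd (dotProductBilin (ZMod p) (ZMod p) (m := Fin n) (A := ZMod p))) = p ^ n ∧
      axisFst (dotProductBilin (ZMod p) (ZMod p) (m := Fin n) (A := ZMod p)) ⊔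
        axisSnd (dotProductBilin (ZMod p) (ZMod p) (m := Fin n) (A := ZMod p)) = ⊤ := by
  have hcard : Nat.card (Fin n → ZMod p) = p ^ n := by
    rw [Nat.card_fun, Nat.card_zmod, Nat.card_eq_fintype_card, Fintype.card_fin]
  refine ⟨natCard_heisenbergDot p n, commutator_heisenbergDot p n hn, natCard_center_heisenbergDot p n,
    (natCard_axisFst _).trans hcard, (natCard_axisSnd _).trans hcard,
    axisFst_sup_axisSnd_eq_top _ fun c => ⟨Pi.single ⟨0, hn⟩ c, Pi.single ⟨0, hn⟩ 1, ?_⟩⟩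
  simp only [dotProductBilin_apply_apply, single_dotProduct, Pi.single_eq_same, mul_one]

end Extraspecial

open Extraspecial

/-- **Murthy 2026, Lemma 2.18 as printed is false.** The printed statement — for every extra-special
group `G` of order `p^{1+2n}`, `n ≥ 1` (here: `p` prime, `|G| = p^{2n+1}`, `|Z(G)| = p`, `G' = Z(G)`,
Dornhoff's definition), any two subgroups `S, T` of order `pⁿ` satisfy `⟨S, T⟩ < G` — fails in
`(𝔽_pⁿ × 𝔽_pⁿ) × 𝔽_p` for the two axis subgroups (`axis_heisenbergDot`), already for `p = 2`, `n = 1`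
(`D₈`) and for the case `n ≥ 2` invoked in the printed proof of the note's Thm. 4.1.
[cite: Murthy2026, Lemma 2.18] -/
theorem Murthy2026_lemma218_false :
    ¬ (∀ (G : Type) [Group G] [Finite G] (p n : ℕ), p.Prime → 0 < n →
        Nat.card G = p ^ (2 * n + 1) → commutator G = Subgroup.center G →
        Nat.card (Subgroup.center G) = p →
        ∀ S T : Subgroup G, Nat.card S = p ^ n → Nat.card T = p ^ n → S ⊔ T ≠ ⊤) := by
  intro h
  obtain ⟨hG, hcomm, hZ, hS, hT, htop⟩ := axis_heisenbergDot 2 2 two_pos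
  haveI : Finite (Heisenberg (polar (dotProductBilin (ZMod 2) (ZMod 2) (m := Fin 2) (A := ZMod 2)))) :=
    Nat.finite_of_card_ne_zero (by rw [hG]; norm_num)
  exact h _ 2 2 Nat.prime_two two_pos hG hcomm hZ _ _ hS hT htop

end Literature.RepresentationTheory.FiniteGroups
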